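import Summits.HubbardSuperconductivity.HubbardSuperconductivity.Theorems.BalabanIRBirBdGPhaseCoercivityLyapunovHat
import Summits.HubbardSuperconductivity.HubbardSuperconductivity.Theorems.BalabanIRBirGappedPhaseReductionTwoBlock
import Literature.MathematicalPhysics.QuantumLattice.FinDimSpectrum
import HarnessLib

/-!
# Route BalabanIR — crux 4 `BirGappedPhaseReduction` (item `stmt-HubbardSuperconductivity-2082`):
# mode factorisation of the zero-mode Trotter determinant of the BdG torus reference

Dictionary step (temporal half of hypothesis (C), zero spatial mode). With the Trotter determinant
formula (`Literature/…/BdGBondHamiltonianTrotterDeterminant`: the Fock weight of a BdG phase history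
is `e^{-aMC} det(1 + ∏_t e^{-a𝓗_t})`), the gauge telescoping
(`Literature/…/BdGNambuMatrixPhaseRotation`: for slice-constant phases only the jumps
`U_t = diag(e^{-iδ_t/2}·1, e^{+iδ_t/2}·1)` enter) and the transport
`bdgNambuMatrix_transport_eq_reindex_fromBlocks` (Nambu matrix = `fromBlocks h D Dᴴ (-h)`), the
zero-mode weight of the translation-invariant reference is `det(1 + ∏_t e^{-aB} U_t)` with
`B = fromBlocks (circulant η) (circulant Δ) (circulant Δ)ᴴ (-circulant η)` on `(ℤ/L)² ⊕ (ℤ/L)²`. This file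
block-diagonalises it by the doubled plane waves of `…BirBdGPhaseCoercivityFourier` (`A^ = L⁻² V A Vᴴ`,
`V = W ⊕ W`):

* scaled conjugation (`hat_add` REUSED from `…LyapunovHat`): `hat_smul`, `hat_neg`, `hat_list_prod`, `det_hat`
  (`det A^ = det A`), `hat_exp` / `hat_gibbsWeight` (`(e^{-aA})^ = e^{-aA^}`: `^` is a continuous
  ring endomorphism, `map_exp`);
* block data (`Φ(F) = fromBlocks` of the four entry-diagonals, `…TwoBlock`): `smul_fromBlocks_diagonal`,
  `gibbsWeight_fromBlocks_diagonal` (`e^{-aΦ(F)} = Φ(e^{-aF_k})`), `det_one_add_prod_map_fromBlocks_diagonal`;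
* `hat_bdgBlocks` — `B^ = Φ(k ↦ h_k)`, `h_k = !![η̂ k, Δ̂ k; conj Δ̂ k, -η̂ k]` (`^ = torusFourier`);
  `hat_nambuStep` — `U_t^ = Φ(k ↦ diag(e^{-iδ/2}, e^{+iδ/2}))`;
* **`det_one_add_prod_torusBdG_eq_prod_modes`** —
  `det(1 + ∏_t e^{-aB} U_t) = ∏_k det(1₂ + ∏_t e^{-a h_k} diag(e^{-iδ_t/2}, e^{+iδ_t/2}))`:
  the zero-mode fermionic weight is a product of one-mode two-state determinants
  (bounded in `…TwoStateDeterminant`; assembled in the companion `…TemporalModes` file).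

`Theses`-free, no definitions; `--supports` the crux. References: Friedli–Velenik 2017 §10.4
(discrete Fourier analysis); de Gennes (1966) Ch. 5. [folklore]
-/

noncomputable section

namespace Summit.HubbardSuperconductivity.HubbardSuperconductivity.Theorems

namespace BirBdG

open Matrix NormedSpace Literature.Probability.LatticeModels
open scoped Matrix.Norms.Operator ComplexConjugate

/-! ### More on the scaled conjugation `A ↦ N⁻¹ V A Vᴴ` -/

section Scaled2

variable {n : Type*} [Fintype n] [DecidableEq n] {V : Matrix n n ℂ} {N : ℕ}

omit [DecidableEq n] in
/-- The scaled conjugation commutes with scalars. [folklore] -/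
theorem hat_smul (c : ℂ) (A : Matrix n n ℂ) :
    (N : ℂ)⁻¹ • (V * (c • A) * Vᴴ) = c • ((N : ℂ)⁻¹ • (V * A * Vᴴ)) := by
  rw [Matrix.mul_smul, Matrix.smul_mul, smul_comm]

omit [DecidableEq n] in
/-- The scaled conjugation commutes with negation. [folklore] -/
theorem hat_neg (A : Matrix n n ℂ) :
    (N : ℂ)⁻¹ • (V * (-A) * Vᴴ) = -((N : ℂ)⁻¹ • (V * A * Vᴴ)) := by
  rw [Matrix.mul_neg, Matrix.neg_mul, smul_neg]

/-- The scaled conjugation of a list product is the product of the conjugates. [folklore] -/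
theorem hat_list_prod (hN : N ≠ 0) (h1 : Vᴴ * V = (N : ℂ) • (1 : Matrix n n ℂ))
    (h2 : V * Vᴴ = (N : ℂ) • (1 : Matrix n n ℂ)) :
    ∀ l : List (Matrix n n ℂ),
      (N : ℂ)⁻¹ • (V * l.prod * Vᴴ) = (l.map fun A => (N : ℂ)⁻¹ • (V * A * Vᴴ)).prod
  | [] => by rw [List.prod_nil, List.map_nil, List.prod_nil, hat_one hN h2]
  | A :: l => by
    rw [List.prod_cons, List.map_cons, List.prod_cons, ← hat_list_prod hN h1 h2 l, hat_mul hN h1]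

/-- The scaled conjugation preserves determinants: `det(N⁻¹ V A Vᴴ) = det A`. [folklore] -/
theorem det_hat (hN : N ≠ 0) (h2 : V * Vᴴ = (N : ℂ) • (1 : Matrix n n ℂ)) (A : Matrix n n ℂ) :
    ((N : ℂ)⁻¹ • (V * A * Vᴴ)).det = A.det := by
  have key : ∀ X : Matrix n n ℂ, ((N : ℂ)⁻¹ • (V * X * Vᴴ)).det =
      ((N : ℂ)⁻¹) ^ Fintype.card n * V.det * Vᴴ.det * X.det := fun X => by
    rw [det_smul, det_mul, det_mul]; ring
  have h1' := key 1
  rw [hat_one hN h2, det_one, mul_one] at h1'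
  rw [key, ← h1', one_mul]

/-- The scaled conjugation commutes with the exponential (it is a continuous ring endomorphism).
[folklore] -/
theorem hat_exp (hN : N ≠ 0) (h1 : Vᴴ * V = (N : ℂ) • (1 : Matrix n n ℂ))
    (h2 : V * Vᴴ = (N : ℂ) • (1 : Matrix n n ℂ)) (A : Matrix n n ℂ) :
    (N : ℂ)⁻¹ • (V * exp A * Vᴴ) = exp ((N : ℂ)⁻¹ • (V * A * Vᴴ)) := by
  let φ : Matrix n n ℂ →+* Matrix n n ℂ :=
    { toFun := fun X => (N : ℂ)⁻¹ • (V * X * Vᴴ)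
      map_one' := hat_one hN h2
      map_mul' := fun X Y => (hat_mul hN h1 X Y).symm
      map_zero' := by simp
      map_add' := hat_add }
  have hcont : Continuous φ := by
    show Continuous (fun X : Matrix n n ℂ => (N : ℂ)⁻¹ • (V * X * Vᴴ))
    exact (((continuous_const (y := V)).matrix_mul continuous_id).matrix_mul
      (continuous_const (y := Vᴴ))).const_smul ((N : ℂ)⁻¹)
  exact map_exp φ hcont A

/-- The scaled conjugation commutes with Gibbs weights. [folklore] -/
theorem hat_gibbsWeight (hN : N ≠ 0) (h1 : Vᴴ * V = (N : ℂ) • (1 : Matrix n n ℂ))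
    (h2 : V * Vᴴ = (N : ℂ) • (1 : Matrix n n ℂ)) (a : ℝ) (A : Matrix n n ℂ) :
    (N : ℂ)⁻¹ • (V * Matrix.gibbsWeight a A * Vᴴ) = Matrix.gibbsWeight a ((N : ℂ)⁻¹ • (V * A * Vᴴ)) := by
  have h := hat_exp hN h1 h2 (-(a : ℂ) • A)
  rw [hat_smul] at h
  exact h

end Scaled2

/-! ### Gibbs weights of block data -/

section Blocks

variable {m : Type*} [Fintype m] [DecidableEq m]

omit [Fintype m] in
/-- Scalars act blockwise on `Φ(F)`. [folklore] -/
theorem smul_fromBlocks_diagonal (c : ℂ) (F : m → Matrix (Fin 2) (Fin 2) ℂ) :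
    c • fromBlocks (diagonal fun k => F k 0 0) (diagonal fun k => F k 0 1)
        (diagonal fun k => F k 1 0) (diagonal fun k => F k 1 1) =
      fromBlocks (diagonal fun k => (c • F k) 0 0) (diagonal fun k => (c • F k) 0 1)
        (diagonal fun k => (c • F k) 1 0) (diagonal fun k => (c • F k) 1 1) := by
  rw [fromBlocks_smul, ← diagonal_smul, ← diagonal_smul, ← diagonal_smul, ← diagonal_smul]
  rfl

/-- **Gibbs weights of block data are blockwise**: `e^{-aΦ(F)} = Φ(k ↦ e^{-a F k})`. [folklore] -/
theorem gibbsWeight_fromBlocks_diagonal (a : ℝ) (F : m → Matrix (Fin 2) (Fin 2) ℂ) :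
    Matrix.gibbsWeight a (fromBlocks (diagonal fun k => F k 0 0) (diagonal fun k => F k 0 1)
        (diagonal fun k => F k 1 0) (diagonal fun k => F k 1 1)) =
      fromBlocks (diagonal fun k => Matrix.gibbsWeight a (F k) 0 0)
        (diagonal fun k => Matrix.gibbsWeight a (F k) 0 1)
        (diagonal fun k => Matrix.gibbsWeight a (F k) 1 0)
        (diagonal fun k => Matrix.gibbsWeight a (F k) 1 1) := by
  have h := exp_fromBlocks_diagonal (fun k => -(a : ℂ) • F k)
  rw [← smul_fromBlocks_diagonal] at h
  exact h

/-- List form of the block factorisation: `det(1 + ∏_{x∈l} Φ(F x)) = ∏_k det(1₂ + ∏_{x∈l} F x k)`.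
[folklore] -/
theorem det_one_add_prod_map_fromBlocks_diagonal {α : Type*} (l : List α)
    (F : α → m → Matrix (Fin 2) (Fin 2) ℂ) :
    (1 + (l.map fun x => fromBlocks (diagonal fun k => F x k 0 0) (diagonal fun k => F x k 0 1)
        (diagonal fun k => F x k 1 0) (diagonal fun k => F x k 1 1)).prod).det =
      ∏ k, (1 + (l.map fun x => F x k).prod).det := by
  set e : Fin 2 × m ≃ m ⊕ m := (finTwoEquiv.prodCongr (Equiv.refl m)).trans (Equiv.boolProdEquivSum m)
  set Ψ : (m → Matrix (Fin 2) (Fin 2) ℂ) →+* Matrix (m ⊕ m) (m ⊕ m) ℂ :=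
    (reindexAlgEquiv ℂ ℂ e).toRingEquiv.toRingHom.comp (blockDiagonalRingHom (Fin 2) m ℂ) with hΨ
  have hΨF : ∀ G : m → Matrix (Fin 2) (Fin 2) ℂ, Ψ G =
      fromBlocks (diagonal fun k => G k 0 0) (diagonal fun k => G k 0 1)
        (diagonal fun k => G k 1 0) (diagonal fun k => G k 1 1) := fun G => by
    rw [← reindex_blockDiagonal_eq_fromBlocks]
    rfl
  have hlist : (l.map fun x => fromBlocks (diagonal fun k => F x k 0 0) (diagonal fun k => F x k 0 1)
      (diagonal fun k => F x k 1 0) (diagonal fun k => F x k 1 1)) = (l.map F).map Ψ := by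
    rw [List.map_map]
    exact List.map_congr_left fun x _ => (hΨF (F x)).symm
  rw [hlist, ← map_list_prod, ← map_one Ψ, ← map_add]
  have hdet : ∀ G : m → Matrix (Fin 2) (Fin 2) ℂ, (Ψ G).det = ∏ k, (G k).det := fun G => by
    rw [hΨF, det_fromBlocks_diagonal]
  rw [hdet]
  refine Finset.prod_congr rfl fun k _ => ?_
  rw [Pi.add_apply, Pi.one_apply, ← Pi.evalRingHom_apply (fun _ : m => Matrix (Fin 2) (Fin 2) ℂ) k
    (l.map F).prod, map_list_prod, List.map_map]
  rfl

end Blocks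

/-! ### The torus: plane waves block-diagonalise translation-invariant Nambu data -/

section Torus

variable {L : ℕ} [NeZero L]

/-- In the doubled plane-wave basis the BdG block matrix of translation-invariant data
`fromBlocks (circulant η) (circulant Δ) (circulant Δ)ᴴ (-circulant η)` is the block datum
`k ↦ !![η̂ k, Δ̂ k; conj (Δ̂ k), -η̂ k]` (`^ = torusFourier`). [cite: FriedliVelenik2017, §10.4] -/
theorem hat_bdgBlocks (η Δv : TorusSite 2 L → ℂ) :
    ((L ^ 2 : ℕ) : ℂ)⁻¹ • (fromBlocks (Matrix.of fun k x : TorusSite 2 L => conj (torusChar k x)) 0 0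
          (Matrix.of fun k x : TorusSite 2 L => conj (torusChar k x)) *
        fromBlocks (circulant η) (circulant Δv) (circulant Δv)ᴴ (-circulant η) *
        (fromBlocks (Matrix.of fun k x : TorusSite 2 L => conj (torusChar k x)) 0 0
          (Matrix.of fun k x : TorusSite 2 L => conj (torusChar k x)))ᴴ) =
      fromBlocks (diagonal fun k => (!![torusFourier η k, torusFourier Δv k;
            star (torusFourier Δv k), -torusFourier η k] : Matrix (Fin 2) (Fin 2) ℂ) 0 0)
        (diagonal fun k => (!![torusFourier η k, torusFourier Δv k;
            star (torusFourier Δv k), -torusFourier η k] : Matrix (Fin 2) (Fin 2) ℂ) 0 1)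
        (diagonal fun k => (!![torusFourier η k, torusFourier Δv k;
            star (torusFourier Δv k), -torusFourier η k] : Matrix (Fin 2) (Fin 2) ℂ) 1 0)
        (diagonal fun k => (!![torusFourier η k, torusFourier Δv k;
            star (torusFourier Δv k), -torusFourier η k] : Matrix (Fin 2) (Fin 2) ℂ) 1 1) := by
  rw [hat_fromBlocks, hat_conjTranspose, hat_neg, hat_circulant, hat_circulant, diagonal_conjTranspose,
    diagonal_neg]
  simp only [Matrix.of_apply, Matrix.cons_val', Matrix.cons_val_zero, Matrix.cons_val_one,
    Matrix.cons_val_fin_one, Matrix.empty_val']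
  rfl

/-- The Nambu phase step `diag(e^{-iδ/2}·1, e^{+iδ/2}·1)` is untouched by the doubled plane-wave
conjugation and is the constant block datum `k ↦ diag(e^{-iδ/2}, e^{+iδ/2})`. [folklore] -/
theorem hat_nambuStep (c d : ℂ) :
    ((L ^ 2 : ℕ) : ℂ)⁻¹ • (fromBlocks (Matrix.of fun k x : TorusSite 2 L => conj (torusChar k x)) 0 0
          (Matrix.of fun k x : TorusSite 2 L => conj (torusChar k x)) *
        fromBlocks (c • (1 : Matrix (TorusSite 2 L) (TorusSite 2 L) ℂ)) 0 0 (d • 1) *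
        (fromBlocks (Matrix.of fun k x : TorusSite 2 L => conj (torusChar k x)) 0 0
          (Matrix.of fun k x : TorusSite 2 L => conj (torusChar k x)))ᴴ) =
      fromBlocks (diagonal fun _ => (diagonal ![c, d] : Matrix (Fin 2) (Fin 2) ℂ) 0 0)
        (diagonal fun _ => (diagonal ![c, d] : Matrix (Fin 2) (Fin 2) ℂ) 0 1)
        (diagonal fun _ => (diagonal ![c, d] : Matrix (Fin 2) (Fin 2) ℂ) 1 0)
        (diagonal fun _ => (diagonal ![c, d] : Matrix (Fin 2) (Fin 2) ℂ) 1 1) := by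
  have hN : (L ^ 2 : ℕ) ≠ 0 := pow_ne_zero 2 (NeZero.ne L)
  have h2 := planeWave_mul_conjTranspose_self (d := 2) (L := L)
  rw [hat_fromBlocks, hat_smul, hat_smul, hat_one hN h2, Matrix.mul_zero, Matrix.zero_mul, smul_zero]
  ext (i | i) (j | j)
  · simp [diagonal_apply, Matrix.one_apply]
  · simp
  · simp
  · simp [diagonal_apply, Matrix.one_apply]

/-- **Mode factorisation of the zero-mode Trotter determinant on the torus.** For
translation-invariant BdG block data `B = fromBlocks (circulant η) (circulant Δ) (circulant Δ)ᴴ (-circulant η)`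
on `(ℤ/L)² ⊕ (ℤ/L)²`, a Trotter step `a` and any list of slice-constant Nambu phase steps
`U_t = diag(e^{-iδ_t/2}·1, e^{+iδ_t/2}·1)`:
`det(1 + ∏_t e^{-aB} U_t) = ∏_k det(1₂ + ∏_t e^{-a h_k} diag(e^{-iδ_t/2}, e^{+iδ_t/2}))` with the
`2 × 2` symbol blocks `h_k = !![η̂ k, Δ̂ k; conj Δ̂ k, -η̂ k]` (`^ = torusFourier`): the fermionic weight
of a zero-mode pair-phase history is a product of one-mode two-state determinants.
[cite: FriedliVelenik2017, §10.4] -/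
theorem det_one_add_prod_torusBdG_eq_prod_modes (η Δv : TorusSite 2 L → ℂ) (a : ℝ) (δs : List ℝ) :
    (1 + (δs.map fun δ => Matrix.gibbsWeight a
        (fromBlocks (circulant η) (circulant Δv) (circulant Δv)ᴴ (-circulant η)) *
        fromBlocks (Complex.exp (((-(δ / 2) : ℝ) : ℂ) * Complex.I) •
            (1 : Matrix (TorusSite 2 L) (TorusSite 2 L) ℂ)) 0 0
          (Complex.exp (((δ / 2 : ℝ) : ℂ) * Complex.I) • 1)).prod).det =
      ∏ k : TorusSite 2 L, (1 + (δs.map fun δ =>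
        Matrix.gibbsWeight a (!![torusFourier η k, torusFourier Δv k;
            star (torusFourier Δv k), -torusFourier η k] : Matrix (Fin 2) (Fin 2) ℂ) *
        diagonal ![Complex.exp (((-(δ / 2) : ℝ) : ℂ) * Complex.I),
          Complex.exp (((δ / 2 : ℝ) : ℂ) * Complex.I)]).prod).det := by
  have hN : (L ^ 2 : ℕ) ≠ 0 := pow_ne_zero 2 (NeZero.ne L)
  have hV1 := fromBlocks_conjTranspose_mul_self (planeWave_conjTranspose_mul_self (d := 2) (L := L))
  have hV2 := fromBlocks_mul_conjTranspose_self (planeWave_mul_conjTranspose_self (d := 2) (L := L))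
  -- each factor in the plane-wave basis is a block datum
  have hfac : ∀ δ : ℝ,
      ((L ^ 2 : ℕ) : ℂ)⁻¹ • (fromBlocks (Matrix.of fun k x : TorusSite 2 L => conj (torusChar k x)) 0 0
          (Matrix.of fun k x : TorusSite 2 L => conj (torusChar k x)) *
        (Matrix.gibbsWeight a (fromBlocks (circulant η) (circulant Δv) (circulant Δv)ᴴ (-circulant η)) *
          fromBlocks (Complex.exp (((-(δ / 2) : ℝ) : ℂ) * Complex.I) •
              (1 : Matrix (TorusSite 2 L) (TorusSite 2 L) ℂ)) 0 0
            (Complex.exp (((δ / 2 : ℝ) : ℂ) * Complex.I) • 1)) *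
        (fromBlocks (Matrix.of fun k x : TorusSite 2 L => conj (torusChar k x)) 0 0
          (Matrix.of fun k x : TorusSite 2 L => conj (torusChar k x)))ᴴ) =
      fromBlocks
        (diagonal fun k => (Matrix.gibbsWeight a (!![torusFourier η k, torusFourier Δv k;
            star (torusFourier Δv k), -torusFourier η k] : Matrix (Fin 2) (Fin 2) ℂ) *
          diagonal ![Complex.exp (((-(δ / 2) : ℝ) : ℂ) * Complex.I),
            Complex.exp (((δ / 2 : ℝ) : ℂ) * Complex.I)]) 0 0)
        (diagonal fun k => (Matrix.gibbsWeight a (!![torusFourier η k, torusFourier Δv k;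
            star (torusFourier Δv k), -torusFourier η k] : Matrix (Fin 2) (Fin 2) ℂ) *
          diagonal ![Complex.exp (((-(δ / 2) : ℝ) : ℂ) * Complex.I),
            Complex.exp (((δ / 2 : ℝ) : ℂ) * Complex.I)]) 0 1)
        (diagonal fun k => (Matrix.gibbsWeight a (!![torusFourier η k, torusFourier Δv k;
            star (torusFourier Δv k), -torusFourier η k] : Matrix (Fin 2) (Fin 2) ℂ) *
          diagonal ![Complex.exp (((-(δ / 2) : ℝ) : ℂ) * Complex.I),
            Complex.exp (((δ / 2 : ℝ) : ℂ) * Complex.I)]) 1 0)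
        (diagonal fun k => (Matrix.gibbsWeight a (!![torusFourier η k, torusFourier Δv k;
            star (torusFourier Δv k), -torusFourier η k] : Matrix (Fin 2) (Fin 2) ℂ) *
          diagonal ![Complex.exp (((-(δ / 2) : ℝ) : ℂ) * Complex.I),
            Complex.exp (((δ / 2 : ℝ) : ℂ) * Complex.I)]) 1 1) := by
    intro δ
    rw [← hat_mul hN hV1, hat_gibbsWeight hN hV1 hV2, hat_bdgBlocks, hat_nambuStep,
      gibbsWeight_fromBlocks_diagonal, fromBlocks_diagonal_mul]
  rw [← det_hat hN hV2, hat_add, hat_one hN hV2, hat_list_prod hN hV1 hV2, List.map_map]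
  rw [show ((fun A : Matrix (TorusSite 2 L ⊕ TorusSite 2 L) (TorusSite 2 L ⊕ TorusSite 2 L) ℂ =>
      ((L ^ 2 : ℕ) : ℂ)⁻¹ • (fromBlocks (Matrix.of fun k x : TorusSite 2 L => conj (torusChar k x)) 0 0
          (Matrix.of fun k x : TorusSite 2 L => conj (torusChar k x)) * A *
        (fromBlocks (Matrix.of fun k x : TorusSite 2 L => conj (torusChar k x)) 0 0
          (Matrix.of fun k x : TorusSite 2 L => conj (torusChar k x)))ᴴ)) ∘
      (fun δ : ℝ => Matrix.gibbsWeight a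
          (fromBlocks (circulant η) (circulant Δv) (circulant Δv)ᴴ (-circulant η)) *
        fromBlocks (Complex.exp (((-(δ / 2) : ℝ) : ℂ) * Complex.I) •
            (1 : Matrix (TorusSite 2 L) (TorusSite 2 L) ℂ)) 0 0
          (Complex.exp (((δ / 2 : ℝ) : ℂ) * Complex.I) • 1))) = _ from funext hfac]
  exact det_one_add_prod_map_fromBlocks_diagonal (m := TorusSite 2 L) δs fun δ k =>
    Matrix.gibbsWeight a (!![torusFourier η k, torusFourier Δv k;
        star (torusFourier Δv k), -torusFourier η k] : Matrix (Fin 2) (Fin 2) ℂ) *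
      diagonal ![Complex.exp (((-(δ / 2) : ℝ) : ℂ) * Complex.I),
        Complex.exp (((δ / 2 : ℝ) : ℂ) * Complex.I)]

end Torus

end BirBdG

end Summit.HubbardSuperconductivity.HubbardSuperconductivity.Theorems
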